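import Literature.AlgebraicGeometry.AbelianSchemes.PoincarePullbackTorsion
import Literature.AlgebraicGeometry.AbelianSchemes.PoincareStabilizerDualKernel
import Literature.AlgebraicGeometry.AbelianSchemes.AbelianSchemeConstSubgroupQuotient
import Mathlib.FieldTheory.IsAlgClosed.AlgebraicClosure
import HarnessLib

/-!
# The character step `hChar` of the (K) assembly from a point count — «a constant `n`-torsion section translating a
# `U`-point of `Â` without changing the class of `N = (π × 1_Â)^*𝒫 ` lies in `K′`»

Layer `Literature/AlgebraicGeometry/AbelianSchemes`, namespace `Literature.AlgebraicGeometry.AbelianSchemes.AbelianSchemeOver.DualPair`.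
THEOREMS ONLY (no definition, no named fact, no instance, no `sorry`); sequel of ★ `PoincarePullbackTorsion` (B-p05 (g15), the
`hTors` input) in the same currency: `A/S` an abelian scheme over a reduced locally Noetherian base, `D = (Â, 𝒫)` a dual pair with the
unit hypothesis `hD`, `X/S` an abelian scheme with an `S`-morphism `π : X → A`, `N := (π × 1_Â)^*𝒫` on `X ×_S Â`, a level-`n`
structure `φ̂` on `Â` and a subgroup `K′ ≤ Â(S)`.

[MumfordAV1970] §15 Thm. 1: for an isogeny `π : X → A` the kernel of `π^* : Â → X̂` is finite, Cartier dual to `ker π`; B-p09 (g10)'s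
assembly ★ `stabilizer_le_of_torsion_of_character` (`PoincarePullbackStabilizerConstant`) reduces «the scheme-theoretic stabiliser of
`N` is the constant group `K′`» to a torsion step `hTors` (★ `PoincarePullbackTorsion`) and a CHARACTER STEP `hChar`: for a constant
section `φ̂(c)`, a non-empty `U → S` and `U`-points `a = a′ · φ̂(c)` of `Â` with `(1_X × a)^*N ≅ (1_X × a′)^*N`, `φ̂(c) ∈ K′`.
This file proves `hChar` from FIBREWISE inputs by COUNTING:

* §1 restriction of `(1_X × a)^*N` along a point `ū : V → U` of the parameter scheme (`pullbackLift_comp_baseChangeToProd`,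
  `nonempty_pullback_baseChangeToProd_comp_iso`);
* §2 a section `k` with `(π × k)^*𝒫 ≅ 𝒪_X` (★ `dualKernelSet`; = «`k` stabilises `N`» by ★ (K-dict)
  `nonempty_pullback_whiskerLeft_translation_iso_iff`) has trivial class `(1_X × k(s))^*N ≅ 𝒪` at every field-valued point
  (`nonempty_pullback_baseChangeToProd_restrict_iso_unit`);
* §3 the COUNT at one geometric point (`section_mem_of_triv_of_ncard_le`): if `φ̂(c)(t)` and all `k(t)`, `k ∈ K′`, have trivial
  class and `#{b ∈ Â_t(Ω) | (1_X × b)^*N ≅ 𝒪} ≤ #{c′ | φ̂(c′) ∈ K′}`, then `φ̂(c) ∈ K′` — the points `φ̂(c′)(t)` are pairwise distinct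
  (★ `LevelStructure.basis_injective`) elements of that finite set, hence exhaust it; the ⊗-difference over the parameter scheme
  (`nonempty_pullback_baseChangeToProd_const_iso_unit`: `a = a′·σ` and `(1_X × a)^*N ≅ (1_X × a′)^*N` give `(1_X × σ|_U)^*N ≅ 𝒪`, ★
  (K1) `nonempty_pullback_pullbackP_mul_inv_iso_unit` along `π_U` + ★ `comp_translation`); and the three ASSEMBLIES of `hChar`
  VERBATIM: **`section_mem_of_ncard_le`** (the count at EVERY geometric point: restrict to a geometric point of `U`, no spreading),
  **`section_mem_of_spread_of_ncard_le`** (the road of record (R-ℂ): the count at the points with values in ONE algebraically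
  closed field `Ω₀`, plus a SPREADING hypothesis «trivial over a non-empty `U` ⇒ trivial at some `Ω₀`-point», which is ★ (K4)
  `nonempty_iso_unit_of_pullback_quotientMk_iso_unit_of_nonempty` on the connected component in the quotient instantiation), and
  `section_mem_of_stabilizer_of_ncard_le` (input `K′ ⊆ Stab(N)` instead of §2's dual-kernel form).

Cell `hodgecm-mathlib` (D-0151), HECKE-LINK socket (B), brick (K5b) «`hChar` assembly» (director s192 / B-plan1 (g14) 22:55:01Z;
consumer B-p09 (g10) ★ `hStab_of_hChar`); the residual inputs are (hcard) = B-p15 (g10)'s census (I1)+(I2)+(I3) at a complex point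
and (hspread) = ★ (K4) + «every component has a complex point».  Count-neutral.  HC_CM is proved only modulo the 7 printed citations
until rung 0 closes.

## References
* [MumfordAV1970] D. Mumford, *Abelian Varieties* (1970), §15 Thm. 1 (p. 143).
* [MilneAV2008] J. S. Milne, *Abelian Varieties* (v2.00, 2008), I §8 pp. 36–37, I §9.
* [MumfordFogartyKirwan1994] D. Mumford, J. Fogarty, F. Kirwan, *Geometric Invariant Theory*, 3rd ed. (1994), Ch. 7 §2 Definition 7.1
  (p. 129).
-/

noncomputable section

universe u

open CategoryTheory CategoryTheory.Limits AlgebraicGeometry MonoidalCategory CartesianMonoidalCategory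
open scoped MonObj

-- `Scheme.Modules` / `SheafOfModules` are not reducible (as in Mathlib's `AlgebraicGeometry/Modules/Sheaf.lean`).
set_option backward.isDefEq.respectTransparency false

namespace Literature.AlgebraicGeometry.AbelianSchemes

namespace AbelianSchemeOver

open Literature.AlgebraicGeometry.Motives Literature.AlgebraicGeometry.AbelianVarieties
  Literature.AlgebraicGeometry.Modules

variable {S : Scheme.{u}} {X A : AbelianSchemeOver S}

namespace DualPair

variable (D : A.DualPair) (π : X.X ⟶ A.X)

/-! ## §1 Restricting `(1_X × a)^*N` along a point `ū : Spec Ω → U` of the parameter scheme -/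

/-- The base-change map `X_{Spec Ω} → X_U` along `ū : Spec Ω → U` followed by `1_X × a` is `1_X × (ū ≫ a)`.
[cite: MilneAV2008, I §8 pp. 36–37] -/
theorem pullbackLift_comp_baseChangeToProd {U V : Scheme.{u}} (w : U ⟶ S) (ū : V ⟶ U) (a : U ⟶ D.hat.X.left)
    (ha : a ≫ D.hat.X.hom = w) :
    pullback.lift (pullback.fst X.X.hom (ū ≫ w)) (pullback.snd X.X.hom (ū ≫ w) ≫ ū)
        (by rw [pullback.condition, Category.assoc]) ≫ X.baseChangeToProd D.hat w a ha =
      X.baseChangeToProd D.hat (ū ≫ w) (ū ≫ a) (by rw [Category.assoc, ha]) := by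
  apply pullback.hom_ext
  · rw [Category.assoc, baseChangeToProd_fst, pullback.lift_fst, baseChangeToProd_fst]
  · rw [Category.assoc, baseChangeToProd_snd, pullback.lift_snd_assoc, baseChangeToProd_snd, Category.assoc]

/-- **Restriction of an isomorphism `(1_X × a)^*N ≅ (1_X × a′)^*N` along a point `ū : V → U` of the parameter scheme**:
`(1_X × (ū ≫ a))^*N ≅ (1_X × (ū ≫ a′))^*N` (pull back along `X_V → X_U`, Mathlib `Scheme.Modules.pullbackComp`).
[cite: MilneAV2008, I §8 pp. 36–37] -/
theorem nonempty_pullback_baseChangeToProd_comp_iso {U V : Scheme.{u}} (w : U ⟶ S) (ū : V ⟶ U)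
    (a a' : U ⟶ D.hat.X.left) (ha : a ≫ D.hat.X.hom = w) (ha' : a' ≫ D.hat.X.hom = w) (N : (X.prodLeft D.hat).Modules)
    (h : Nonempty ((Scheme.Modules.pullback (X.baseChangeToProd D.hat w a ha)).obj N ≅
      (Scheme.Modules.pullback (X.baseChangeToProd D.hat w a' ha')).obj N)) :
    Nonempty ((Scheme.Modules.pullback (X.baseChangeToProd D.hat (ū ≫ w) (ū ≫ a) (by rw [Category.assoc, ha]))).obj N ≅
      (Scheme.Modules.pullback (X.baseChangeToProd D.hat (ū ≫ w) (ū ≫ a') (by rw [Category.assoc, ha']))).obj N) := by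
  obtain ⟨e⟩ := h
  set j : pullback X.X.hom (ū ≫ w) ⟶ pullback X.X.hom w :=
    pullback.lift (pullback.fst X.X.hom (ū ≫ w)) (pullback.snd X.X.hom (ū ≫ w) ≫ ū)
      (by rw [pullback.condition, Category.assoc]) with hj
  refine ⟨((Scheme.Modules.pullbackCongr (D.pullbackLift_comp_baseChangeToProd (X := X) w ū a ha)).app N).symm ≪≫
    ((Scheme.Modules.pullbackComp j (X.baseChangeToProd D.hat w a ha)).app N).symm ≪≫
    (Scheme.Modules.pullback j).mapIso e ≪≫
    (Scheme.Modules.pullbackComp j (X.baseChangeToProd D.hat w a' ha')).app N ≪≫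
    (Scheme.Modules.pullbackCongr (D.pullbackLift_comp_baseChangeToProd (X := X) w ū a' ha')).app N⟩

/-! ## §2 Sections with trivial class `(π × k)^*𝒫 ≅ 𝒪` have trivial class at every geometric point -/

/-- `(1_X × k(s)) ≫ (π × 1_Â) = pr_X ≫ (π, k ∘ str) : X_s → A ×_S Â` for a section `k` of `Â` and a field-valued point `s`.
[cite: MilneAV2008, I §8 pp. 36–37] -/
theorem baseChangeToProd_restrict_comp_whiskerRight_left {Ω : Type u} [Field Ω] (s : Spec (.of Ω) ⟶ S)
    (k : D.hat.Sections) :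
    X.baseChangeToProd D.hat s (D.hat.restrict s k).left (Over.w _) ≫ (π ▷ D.hat.X).left =
      pullback.fst X.X.hom s ≫ (lift π (toUnit X.X ≫ k)).left := by
  apply pullback.hom_ext
  · rw [Category.assoc, Category.assoc]
    calc X.baseChangeToProd D.hat s (D.hat.restrict s k).left (Over.w _) ≫ ((π ▷ D.hat.X).left ≫
          pullback.fst A.X.hom D.hat.X.hom)
        = X.baseChangeToProd D.hat s (D.hat.restrict s k).left (Over.w _) ≫ ((π ▷ D.hat.X) ≫ fst A.X D.hat.X).left := rfl
      _ = X.baseChangeToProd D.hat s (D.hat.restrict s k).left (Over.w _) ≫ (fst X.X D.hat.X ≫ π).left := by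
          rw [whiskerRight_fst]
      _ = (X.baseChangeToProd D.hat s (D.hat.restrict s k).left (Over.w _) ≫ pullback.fst X.X.hom D.hat.X.hom) ≫ π.left :=
          (Category.assoc _ _ _).symm
      _ = pullback.fst X.X.hom s ≫ π.left := by rw [baseChangeToProd_fst]
      _ = pullback.fst X.X.hom s ≫ (lift π (toUnit X.X ≫ k) ≫ fst A.X D.hat.X).left := by rw [lift_fst]
      _ = pullback.fst X.X.hom s ≫ ((lift π (toUnit X.X ≫ k)).left ≫ pullback.fst A.X.hom D.hat.X.hom) := rfl
  · rw [Category.assoc, Category.assoc]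
    calc X.baseChangeToProd D.hat s (D.hat.restrict s k).left (Over.w _) ≫ ((π ▷ D.hat.X).left ≫
          pullback.snd A.X.hom D.hat.X.hom)
        = X.baseChangeToProd D.hat s (D.hat.restrict s k).left (Over.w _) ≫ ((π ▷ D.hat.X) ≫ snd A.X D.hat.X).left := rfl
      _ = X.baseChangeToProd D.hat s (D.hat.restrict s k).left (Over.w _) ≫ (snd X.X D.hat.X).left := by
          rw [whiskerRight_snd]
      _ = X.baseChangeToProd D.hat s (D.hat.restrict s k).left (Over.w _) ≫ pullback.snd X.X.hom D.hat.X.hom := rfl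
      _ = pullback.snd X.X.hom s ≫ (D.hat.restrict s k).left := by rw [baseChangeToProd_snd]
      _ = pullback.snd X.X.hom s ≫ (s ≫ k.left) := by rw [Over.comp_left, Over.toUnit_left]; rfl
      _ = (pullback.fst X.X.hom s ≫ X.X.hom) ≫ k.left := by rw [← Category.assoc, pullback.condition]
      _ = pullback.fst X.X.hom s ≫ (toUnit X.X ≫ k).left := by rw [Over.comp_left, Over.toUnit_left, Category.assoc]
      _ = pullback.fst X.X.hom s ≫ (lift π (toUnit X.X ≫ k) ≫ snd A.X D.hat.X).left := by rw [lift_snd]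
      _ = pullback.fst X.X.hom s ≫ ((lift π (toUnit X.X ≫ k)).left ≫ pullback.snd A.X.hom D.hat.X.hom) := rfl

/-- **A section `k` of `Â` with `(π × k)^*𝒫 ≅ 𝒪_X` (the ★ `dualKernelSet` / stabiliser condition, ★ (K-dict)
`nonempty_pullback_whiskerLeft_translation_iso_iff`) has trivial class `(1_X × k(s))^*N ≅ 𝒪` at every field-valued point
`s`** (restrict along `X_s → X`). [cite: MumfordAV1970, §15 Thm. 1 (p. 143)] [cite: MilneAV2008, I §8 pp. 36–37] -/
theorem nonempty_pullback_baseChangeToProd_restrict_iso_unit (k : D.hat.Sections)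
    (hk : Nonempty ((Scheme.Modules.pullback (lift π (toUnit X.X ≫ k)).left).obj D.P ≅ SheafOfModules.unit _))
    {Ω : Type u} [Field Ω] (s : Spec (.of Ω) ⟶ S) :
    Nonempty ((Scheme.Modules.pullback (X.baseChangeToProd D.hat s (D.hat.restrict s k).left (Over.w _))).obj
      ((Scheme.Modules.pullback (π ▷ D.hat.X).left).obj D.P) ≅ SheafOfModules.unit _) := by
  obtain ⟨i⟩ := hk
  exact ⟨(Scheme.Modules.pullbackComp _ _).app D.P ≪≫
    (Scheme.Modules.pullbackCongr (D.baseChangeToProd_restrict_comp_whiskerRight_left (X := X) π s k)).app D.P ≪≫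
    ((Scheme.Modules.pullbackComp _ _).app D.P).symm ≪≫
    (Scheme.Modules.pullback (pullback.fst X.X.hom s)).mapIso i ≪≫
    RigidifiedLineBundle.pullbackUnitIso _⟩

/-! ## §3 `hChar` from the stabiliser bound at geometric points -/

variable [IsReduced S] [IsLocallyNoetherian S]

/-- **The character step `hChar` of ★ `stabilizer_le_of_torsion_of_character`, from two fibrewise inputs.**  Let `N := (π × 1_Â)^*𝒫`
on `X ×_S Â`, `φ̂` a level-`n` structure on `Â`, `K′` a subgroup of sections of `Â`.  Suppose (hK′) every `k ∈ K′` has, at every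
geometric point `s`, trivial class `(1_X × k(s))^*N ≅ 𝒪`, and (hcard) at every geometric point the set `T_s` of `Ω`-points `b` of `Â_s`
with `(1_X × b)^*N ≅ 𝒪` is finite with `#T_s ≤ #{c | φ̂(c) ∈ K′}`.  Then for every constant section `φ̂(c)`, every non-empty `U → S`
and `U`-points `a = a′ · φ̂(c)` of `Â` with `(1_X × a)^*N ≅ (1_X × a′)^*N`, `φ̂(c) ∈ K′`.  Proof: restrict to a geometric point `ū` of
`U` (§1); the ⊗-difference ★ (K1) `nonempty_pullback_pullbackP_mul_inv_iso_unit` makes the class of `φ̂(c)(s) = b b′⁻¹` trivial,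
i.e. `φ̂(c)(s) ∈ T_s`; the points `φ̂(c′)(s)`, `φ̂(c′) ∈ K′`, are `#{c′ | φ̂(c′) ∈ K′}` distinct elements of `T_s` (★ level structure:
`basis_injective`), so they exhaust `T_s`, and `φ̂(c)(s) = φ̂(c′)(s)` forces `c = c′`.
[cite: MumfordAV1970, §15 Thm. 1 (p. 143)] [cite: MumfordFogartyKirwan1994, Ch. 7 §2 Definition 7.1 (p. 129)] -/
theorem section_mem_of_ncard_le {n g : ℕ}
    (hD : Nonempty ((Scheme.Modules.pullback (unitHatSlice D)).obj D.P ≅ SheafOfModules.unit _))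
    (K' : Subgroup D.hat.Sections) (φ : LevelStructure g n D.hat)
    (hK' : ∀ k ∈ K', ∀ ⦃Ω : Type u⦄ [Field Ω] [IsAlgClosed Ω] (s : Spec (.of Ω) ⟶ S),
      Nonempty ((Scheme.Modules.pullback (X.baseChangeToProd D.hat s (D.hat.restrict s k).left (Over.w _))).obj
        ((Scheme.Modules.pullback (π ▷ D.hat.X).left).obj D.P) ≅ SheafOfModules.unit _))
    (hcard : ∀ ⦃Ω : Type u⦄ [Field Ω] [IsAlgClosed Ω] (s : Spec (.of Ω) ⟶ S),
      {b : D.hat.FibrePoints s | Nonempty ((Scheme.Modules.pullback (X.baseChangeToProd D.hat s b.left (Over.w b))).obj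
          ((Scheme.Modules.pullback (π ▷ D.hat.X).left).obj D.P) ≅ SheafOfModules.unit _)}.Finite ∧
      {b : D.hat.FibrePoints s | Nonempty ((Scheme.Modules.pullback (X.baseChangeToProd D.hat s b.left (Over.w b))).obj
          ((Scheme.Modules.pullback (π ▷ D.hat.X).left).obj D.P) ≅ SheafOfModules.unit _)}.ncard ≤
        {c : Fin g ⊕ Fin g → ZMod n | φ.section_ c ∈ K'}.ncard)
    (c : Fin g ⊕ Fin g → ZMod n) {U : Scheme.{u}} (w : U ⟶ S) [Nonempty U] (a a' : U ⟶ D.hat.X.left)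
    (ha : a ≫ D.hat.X.hom = w) (ha' : a' ≫ D.hat.X.hom = w)
    (hrel : a = a' ≫ (D.hat.translation (φ.section_ c)).left)
    (h : Nonempty ((Scheme.Modules.pullback (X.baseChangeToProd D.hat w a ha)).obj
        ((Scheme.Modules.pullback (π ▷ D.hat.X).left).obj D.P) ≅
      (Scheme.Modules.pullback (X.baseChangeToProd D.hat w a' ha')).obj
        ((Scheme.Modules.pullback (π ▷ D.hat.X).left).obj D.P))) :
    φ.section_ c ∈ K' := by
  classical
  -- a geometric point `ū : Spec Ω → U`, `Ω` algebraically closed, and the geometric point `s := ū ≫ w` of `S`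
  obtain ⟨u⟩ := (inferInstance : Nonempty U)
  let Ω : Type u := AlgebraicClosure (U.residueField u)
  let ū : Spec (.of Ω) ⟶ U :=
    Spec.map (CommRingCat.ofHom (algebraMap (U.residueField u) Ω)) ≫ U.fromSpecResidueField u
  let s : Spec (.of Ω) ⟶ S := ū ≫ w
  have hbw : (ū ≫ a) ≫ D.hat.X.hom = s := by rw [Category.assoc, ha]
  have hb'w : (ū ≫ a') ≫ D.hat.X.hom = s := by rw [Category.assoc, ha']
  -- the two `Ω`-points `b, b′` of `Â` over `s`, with `b = φ̂(c)(s) · b′`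
  let b : D.hat.FibrePoints s := Over.homMk (ū ≫ a) hbw
  let b' : D.hat.FibrePoints s := Over.homMk (ū ≫ a') hb'w
  have hbb' : b = D.hat.restrict s (φ.section_ c) * b' := by
    have e0 : b = b' ≫ D.hat.translation (φ.section_ c) := Over.OverMorphism.ext (by
      change ū ≫ a = (ū ≫ a') ≫ (D.hat.translation (φ.section_ c)).left
      rw [hrel]
      exact (Category.assoc _ _ _).symm)
    rw [e0, comp_translation]
  have hq : b * b'⁻¹ = D.hat.restrict s (φ.section_ c) := by rw [hbb', mul_inv_cancel_right]
  -- restrict the isomorphism to the point `ū` (§1) and read it through `(1_X × ·)^*N ≅ π_s^*𝒫_·`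
  obtain ⟨e⟩ := D.nonempty_pullback_baseChangeToProd_comp_iso (X := X) w ū a a' ha ha'
    ((Scheme.Modules.pullback (π ▷ D.hat.X).left).obj D.P) h
  obtain ⟨e₁⟩ := D.nonempty_pullback_baseChangeToProd_whiskerRight_iso (X := X) π s (ū ≫ a) hbw
  obtain ⟨e₂⟩ := D.nonempty_pullback_baseChangeToProd_whiskerRight_iso (X := X) π s (ū ≫ a') hb'w
  -- (K1): `π_s^*𝒫_{b b′⁻¹} ≅ 𝒪`, i.e. the class of `φ̂(c)(s)` is trivial
  obtain ⟨i⟩ := D.nonempty_pullback_pullbackP_mul_inv_iso_unit s hD b b' (baseChangeHom π s).left ⟨e₁.symm ≪≫ e ≪≫ e₂⟩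
  have htriv : Nonempty ((Scheme.Modules.pullback
      (X.baseChangeToProd D.hat s (D.hat.restrict s (φ.section_ c)).left (Over.w _))).obj
        ((Scheme.Modules.pullback (π ▷ D.hat.X).left).obj D.P) ≅ SheafOfModules.unit _) := by
    obtain ⟨e₃⟩ := D.nonempty_pullback_baseChangeToProd_whiskerRight_iso (X := X) π s
      (D.hat.restrict s (φ.section_ c)).left (Over.w _)
    rw [← hq]
    rw [← hq] at e₃
    exact ⟨e₃ ≪≫ i⟩
  -- counting at `s`
  obtain ⟨hTfin, hTcard⟩ := hcard s
  set T := {x : D.hat.FibrePoints s | Nonempty ((Scheme.Modules.pullback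
      (X.baseChangeToProd D.hat s x.left (Over.w x))).obj
        ((Scheme.Modules.pullback (π ▷ D.hat.X).left).obj D.P) ≅ SheafOfModules.unit _)} with hT
  set C := {c' : Fin g ⊕ Fin g → ZMod n | φ.section_ c' ∈ K'} with hC
  have hinj : Function.Injective (fun c' : Fin g ⊕ Fin g → ZMod n => D.hat.restrict s (φ.section_ c')) :=
    φ.basis_injective s
  have hsub : (fun c' : Fin g ⊕ Fin g → ZMod n => D.hat.restrict s (φ.section_ c')) '' C ⊆ T := by
    rintro _ ⟨c', hc', rfl⟩
    exact hK' _ hc' s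
  have hIm : ((fun c' : Fin g ⊕ Fin g → ZMod n => D.hat.restrict s (φ.section_ c')) '' C).ncard = C.ncard :=
    Set.ncard_image_of_injective C hinj
  have heq : (fun c' : Fin g ⊕ Fin g → ZMod n => D.hat.restrict s (φ.section_ c')) '' C = T :=
    Set.eq_of_subset_of_ncard_le hsub (hTcard.trans hIm.symm.le) hTfin
  have hmem : D.hat.restrict s (φ.section_ c) ∈ T := htriv
  rw [← heq] at hmem
  obtain ⟨c', hc', hcc'⟩ := hmem
  have hc : c' = c := hinj hcc'
  rw [← hc]
  exact hc'

omit [IsReduced S] [IsLocallyNoetherian S] in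
/-- **The count at ONE geometric point.**  If the class of `φ̂(c)(t)` is trivial (`(1_X × φ̂(c)(t))^*N ≅ 𝒪`), every
`k ∈ K′` has trivial class at `t`, and the set `T_t` of `Ω`-points of `Â_t` with trivial class is finite with
`#T_t ≤ #{c′ | φ̂(c′) ∈ K′}`, then `φ̂(c) ∈ K′`: the points `φ̂(c′)(t)`, `φ̂(c′) ∈ K′`, are distinct (★ `basis_injective`) elements of
`T_t`, hence all of it. [cite: MumfordAV1970, §15 Thm. 1 (p. 143)] [cite: MumfordFogartyKirwan1994, Ch. 7 §2 Definition 7.1 (p. 129)] -/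
theorem section_mem_of_triv_of_ncard_le {n g : ℕ} (K' : Subgroup D.hat.Sections) (φ : LevelStructure g n D.hat)
    {Ω : Type u} [Field Ω] [IsAlgClosed Ω] (t : Spec (.of Ω) ⟶ S) (c : Fin g ⊕ Fin g → ZMod n)
    (htriv : Nonempty ((Scheme.Modules.pullback
      (X.baseChangeToProd D.hat t (D.hat.restrict t (φ.section_ c)).left (Over.w _))).obj
        ((Scheme.Modules.pullback (π ▷ D.hat.X).left).obj D.P) ≅ SheafOfModules.unit _))
    (hK' : ∀ k ∈ K', Nonempty ((Scheme.Modules.pullback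
      (X.baseChangeToProd D.hat t (D.hat.restrict t k).left (Over.w _))).obj
        ((Scheme.Modules.pullback (π ▷ D.hat.X).left).obj D.P) ≅ SheafOfModules.unit _))
    (hfin : {b : D.hat.FibrePoints t | Nonempty ((Scheme.Modules.pullback
      (X.baseChangeToProd D.hat t b.left (Over.w b))).obj
        ((Scheme.Modules.pullback (π ▷ D.hat.X).left).obj D.P) ≅ SheafOfModules.unit _)}.Finite)
    (hcard : {b : D.hat.FibrePoints t | Nonempty ((Scheme.Modules.pullback
      (X.baseChangeToProd D.hat t b.left (Over.w b))).obj
        ((Scheme.Modules.pullback (π ▷ D.hat.X).left).obj D.P) ≅ SheafOfModules.unit _)}.ncard ≤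
      {c' : Fin g ⊕ Fin g → ZMod n | φ.section_ c' ∈ K'}.ncard) :
    φ.section_ c ∈ K' := by
  classical
  set T := {b : D.hat.FibrePoints t | Nonempty ((Scheme.Modules.pullback
      (X.baseChangeToProd D.hat t b.left (Over.w b))).obj
        ((Scheme.Modules.pullback (π ▷ D.hat.X).left).obj D.P) ≅ SheafOfModules.unit _)} with hT
  set C := {c' : Fin g ⊕ Fin g → ZMod n | φ.section_ c' ∈ K'} with hC
  have hinj : Function.Injective (fun c' : Fin g ⊕ Fin g → ZMod n => D.hat.restrict t (φ.section_ c')) :=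
    φ.basis_injective t
  have hsub : (fun c' : Fin g ⊕ Fin g → ZMod n => D.hat.restrict t (φ.section_ c')) '' C ⊆ T := by
    rintro _ ⟨c', hc', rfl⟩
    exact hK' _ hc'
  have hIm : ((fun c' : Fin g ⊕ Fin g → ZMod n => D.hat.restrict t (φ.section_ c')) '' C).ncard = C.ncard :=
    Set.ncard_image_of_injective C hinj
  have heq : (fun c' : Fin g ⊕ Fin g → ZMod n => D.hat.restrict t (φ.section_ c')) '' C = T :=
    Set.eq_of_subset_of_ncard_le hsub (hcard.trans hIm.symm.le) hfin
  have hmem : D.hat.restrict t (φ.section_ c) ∈ T := htriv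
  rw [← heq] at hmem
  obtain ⟨c', hc', hcc'⟩ := hmem
  have hc : c' = c := hinj hcc'
  rw [← hc]
  exact hc'

/-- **The ⊗-difference over the parameter scheme.**  For `U`-points `a = a′ · φ̂(c)` (translation by a constant section
`σ`) of `Â` with `(1_X × a)^*N ≅ (1_X × a′)^*N`, the class of the constant `U`-point `σ|_U` is trivial:
`(1_X × σ|_U)^*N ≅ 𝒪` on `X_U` (★ (K1) `nonempty_pullback_pullbackP_mul_inv_iso_unit` along `π_U`, ★ `comp_translation`).
[cite: MumfordAV1970, §15 Thm. 1 (p. 143)] [cite: MilneAV2008, I §8 pp. 36–37] -/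
theorem nonempty_pullback_baseChangeToProd_const_iso_unit
    (hD : Nonempty ((Scheme.Modules.pullback (unitHatSlice D)).obj D.P ≅ SheafOfModules.unit _))
    (σ : D.hat.Sections) {U : Scheme.{u}} (w : U ⟶ S) (a a' : U ⟶ D.hat.X.left)
    (ha : a ≫ D.hat.X.hom = w) (ha' : a' ≫ D.hat.X.hom = w) (hrel : a = a' ≫ (D.hat.translation σ).left)
    (h : Nonempty ((Scheme.Modules.pullback (X.baseChangeToProd D.hat w a ha)).obj
        ((Scheme.Modules.pullback (π ▷ D.hat.X).left).obj D.P) ≅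
      (Scheme.Modules.pullback (X.baseChangeToProd D.hat w a' ha')).obj
        ((Scheme.Modules.pullback (π ▷ D.hat.X).left).obj D.P))) :
    Nonempty ((Scheme.Modules.pullback (X.baseChangeToProd D.hat w
        ((toUnit (Over.mk w) ≫ σ : Over.mk w ⟶ D.hat.X)).left (Over.w _))).obj
      ((Scheme.Modules.pullback (π ▷ D.hat.X).left).obj D.P) ≅ SheafOfModules.unit _) := by
  -- the two `U`-points as morphisms `Over.mk w ⟶ Â`, with `b = σ|_U · b′`
  set b : Over.mk w ⟶ D.hat.X := Over.homMk a ha with hb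
  set b' : Over.mk w ⟶ D.hat.X := Over.homMk a' ha' with hb'
  have hbb' : b = (toUnit (Over.mk w) ≫ σ) * b' := by
    have e0 : b = b' ≫ D.hat.translation σ := Over.OverMorphism.ext (by
      change a = a' ≫ (D.hat.translation σ).left
      exact hrel)
    rw [e0, comp_translation]
  have hq : b * b'⁻¹ = toUnit (Over.mk w) ≫ σ := by rw [hbb', mul_inv_cancel_right]
  obtain ⟨e⟩ := h
  obtain ⟨e₁⟩ := D.nonempty_pullback_baseChangeToProd_whiskerRight_iso (X := X) π w a ha
  obtain ⟨e₂⟩ := D.nonempty_pullback_baseChangeToProd_whiskerRight_iso (X := X) π w a' ha'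
  -- (K1): `π_U^*𝒫_{b b′⁻¹} ≅ 𝒪`
  obtain ⟨i⟩ := D.nonempty_pullback_pullbackP_mul_inv_iso_unit w hD b b' (baseChangeHom π w).left ⟨e₁.symm ≪≫ e ≪≫ e₂⟩
  obtain ⟨e₃⟩ := D.nonempty_pullback_baseChangeToProd_whiskerRight_iso (X := X) π w
    ((toUnit (Over.mk w) ≫ σ : Over.mk w ⟶ D.hat.X)).left (Over.w _)
  rw [← hq] at e₃ ⊢
  exact ⟨e₃ ≪≫ i⟩

/-- **`hChar` from a SPREADING step and the count at selected points** (the road of record (R-ℂ), B-p09 (g10) 23:11Z): if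
(hK′) every `k ∈ K′` has trivial class at every `Ω₀`-point, (hcard) the count `#T_t ≤ #{c′ | φ̂(c′) ∈ K′}` holds at every
`Ω₀`-point `t`, and (hspread) triviality of the class of a constant section over some non-empty `U → S` propagates to SOME
`Ω₀`-point (★ (K4) `nonempty_iso_unit_of_pullback_quotientMk_iso_unit_of_nonempty` on the connected component + a point of it),
then `hChar` holds — for a fixed algebraically closed test field `Ω₀` (`ℂ` in the Hecke-link line).
[cite: MumfordAV1970, §15 Thm. 1 (p. 143)] [cite: MumfordFogartyKirwan1994, Ch. 7 §2 Definition 7.1 (p. 129)] -/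
theorem section_mem_of_spread_of_ncard_le {n g : ℕ} (Ω₀ : Type u) [Field Ω₀] [IsAlgClosed Ω₀]
    (hD : Nonempty ((Scheme.Modules.pullback (unitHatSlice D)).obj D.P ≅ SheafOfModules.unit _))
    (K' : Subgroup D.hat.Sections) (φ : LevelStructure g n D.hat)
    (hK' : ∀ k ∈ K', ∀ (t : Spec (.of Ω₀) ⟶ S),
      Nonempty ((Scheme.Modules.pullback (X.baseChangeToProd D.hat t (D.hat.restrict t k).left (Over.w _))).obj
        ((Scheme.Modules.pullback (π ▷ D.hat.X).left).obj D.P) ≅ SheafOfModules.unit _))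
    (hcard : ∀ (t : Spec (.of Ω₀) ⟶ S),
      {b : D.hat.FibrePoints t | Nonempty ((Scheme.Modules.pullback (X.baseChangeToProd D.hat t b.left (Over.w b))).obj
          ((Scheme.Modules.pullback (π ▷ D.hat.X).left).obj D.P) ≅ SheafOfModules.unit _)}.Finite ∧
      {b : D.hat.FibrePoints t | Nonempty ((Scheme.Modules.pullback (X.baseChangeToProd D.hat t b.left (Over.w b))).obj
          ((Scheme.Modules.pullback (π ▷ D.hat.X).left).obj D.P) ≅ SheafOfModules.unit _)}.ncard ≤
        {c : Fin g ⊕ Fin g → ZMod n | φ.section_ c ∈ K'}.ncard)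
    (hspread : ∀ (c : Fin g ⊕ Fin g → ZMod n) {U : Scheme.{u}} (w : U ⟶ S) [Nonempty U],
      Nonempty ((Scheme.Modules.pullback (X.baseChangeToProd D.hat w
          ((toUnit (Over.mk w) ≫ φ.section_ c : Over.mk w ⟶ D.hat.X)).left (Over.w _))).obj
        ((Scheme.Modules.pullback (π ▷ D.hat.X).left).obj D.P) ≅ SheafOfModules.unit _) →
      ∃ t : Spec (.of Ω₀) ⟶ S, Nonempty ((Scheme.Modules.pullback
        (X.baseChangeToProd D.hat t (D.hat.restrict t (φ.section_ c)).left (Over.w _))).obj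
          ((Scheme.Modules.pullback (π ▷ D.hat.X).left).obj D.P) ≅ SheafOfModules.unit _))
    (c : Fin g ⊕ Fin g → ZMod n) {U : Scheme.{u}} (w : U ⟶ S) [Nonempty U] (a a' : U ⟶ D.hat.X.left)
    (ha : a ≫ D.hat.X.hom = w) (ha' : a' ≫ D.hat.X.hom = w)
    (hrel : a = a' ≫ (D.hat.translation (φ.section_ c)).left)
    (h : Nonempty ((Scheme.Modules.pullback (X.baseChangeToProd D.hat w a ha)).obj
        ((Scheme.Modules.pullback (π ▷ D.hat.X).left).obj D.P) ≅
      (Scheme.Modules.pullback (X.baseChangeToProd D.hat w a' ha')).obj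
        ((Scheme.Modules.pullback (π ▷ D.hat.X).left).obj D.P))) :
    φ.section_ c ∈ K' := by
  obtain ⟨t, ht⟩ := hspread c w
    (D.nonempty_pullback_baseChangeToProd_const_iso_unit (X := X) π hD (φ.section_ c) w a a' ha ha' hrel h)
  exact D.section_mem_of_triv_of_ncard_le (X := X) π K' φ t c ht (fun k hk => hK' k hk t) (hcard t).1 (hcard t).2

/-- **`hChar` from `K′ ⊆ Stab(N)` and the point count** — the form consumed with the stabiliser hypothesis of the
equivariant structure (★ `poincareStabilizerStructure … (hK′ : K′ ≤ poincareStabilizerSubgroup …)`): every `k ∈ K′` stabilises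
`N` (`(1_X × t_k)^*N ≅ N`), hence lies in the dual kernel (★ (K-dict) `nonempty_pullback_whiskerLeft_translation_iso_iff`) and has
trivial class at every geometric point (§2); with the count `#T_s ≤ #{c | φ̂(c) ∈ K′}` this gives `hChar`.
[cite: MumfordAV1970, §15 Thm. 1 (p. 143)] [cite: MumfordFogartyKirwan1994, Ch. 7 §2 Definition 7.1 (p. 129)] -/
theorem section_mem_of_stabilizer_of_ncard_le {n g : ℕ}
    (hD : Nonempty ((Scheme.Modules.pullback (unitHatSlice D)).obj D.P ≅ SheafOfModules.unit _))
    (K' : Subgroup D.hat.Sections) (φ : LevelStructure g n D.hat)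
    (hK' : ∀ k ∈ K', Nonempty ((Scheme.Modules.pullback (X.X ◁ D.hat.translation k).left).obj
        ((Scheme.Modules.pullback (π ▷ D.hat.X).left).obj D.P) ≅
      (Scheme.Modules.pullback (π ▷ D.hat.X).left).obj D.P))
    (hcard : ∀ ⦃Ω : Type u⦄ [Field Ω] [IsAlgClosed Ω] (s : Spec (.of Ω) ⟶ S),
      {b : D.hat.FibrePoints s | Nonempty ((Scheme.Modules.pullback (X.baseChangeToProd D.hat s b.left (Over.w b))).obj
          ((Scheme.Modules.pullback (π ▷ D.hat.X).left).obj D.P) ≅ SheafOfModules.unit _)}.Finite ∧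
      {b : D.hat.FibrePoints s | Nonempty ((Scheme.Modules.pullback (X.baseChangeToProd D.hat s b.left (Over.w b))).obj
          ((Scheme.Modules.pullback (π ▷ D.hat.X).left).obj D.P) ≅ SheafOfModules.unit _)}.ncard ≤
        {c : Fin g ⊕ Fin g → ZMod n | φ.section_ c ∈ K'}.ncard)
    (c : Fin g ⊕ Fin g → ZMod n) {U : Scheme.{u}} (w : U ⟶ S) [Nonempty U] (a a' : U ⟶ D.hat.X.left)
    (ha : a ≫ D.hat.X.hom = w) (ha' : a' ≫ D.hat.X.hom = w)
    (hrel : a = a' ≫ (D.hat.translation (φ.section_ c)).left)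
    (h : Nonempty ((Scheme.Modules.pullback (X.baseChangeToProd D.hat w a ha)).obj
        ((Scheme.Modules.pullback (π ▷ D.hat.X).left).obj D.P) ≅
      (Scheme.Modules.pullback (X.baseChangeToProd D.hat w a' ha')).obj
        ((Scheme.Modules.pullback (π ▷ D.hat.X).left).obj D.P))) :
    φ.section_ c ∈ K' :=
  D.section_mem_of_ncard_le (X := X) π hD K' φ
    (fun k hk _ _ _ s => D.nonempty_pullback_baseChangeToProd_restrict_iso_unit (X := X) π k
      ((D.nonempty_pullback_whiskerLeft_translation_iso_iff π k hD).1 (hK' k hk)) s)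
    hcard c w a a' ha ha' hrel h

end DualPair

end AbelianSchemeOver

end Literature.AlgebraicGeometry.AbelianSchemes
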